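import Summits.BirchSwinnertonDyer.BirchSwinnertonDyer.Theses.UniversalToricDescent
import Literature.NumberTheory.EllipticCurves.HeegnerModuleIndex
import Literature.Barriers.BirchSwinnertonDyer.TraceZeroHeegnerTowerAtAdditiveSplitP

/-!
# Sketch (utd-idea g55) — crux idea `universal-toric-half-order` on `RationalSplitIMCInclusionAtThree` (stmt-24207)

First checkable statements of the line «the universal toric Heegner family at the wild supercuspidal prime 3 is
(1/2)-tempered, not 1-tempered»: (A) the abstract HALF-TRACE FAMILY over an endomorphism tower (the signed / ♯♭ shape,
typed next to the barrier's `TraceZeroTower.IsTraceZeroFamily`), with its double-step law; (B) the arithmetic first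
lemma `UniversalToricHalfOrderAtThree` over tree declarations (Heegner datum, anticyclotomic layers, geometric points).
Nothing here is asserted; no `sorry`.
-/

set_option autoImplicit false
set_option linter.dupNamespace false

namespace Summit.BirchSwinnertonDyer.BirchSwinnertonDyer.Cruxes.RationalSplitIMCInclusionAtThree.UniversalToricHalfOrder

open Literature.Barriers.BirchSwinnertonDyer.TraceZeroTower

section Abstract

variable {R : Type*} [CommRing R] {H : Type*} [AddCommGroup H] [Module R H]

/-- **Half-trace family** along the `p`-power tower of an automorphism `γ` (layers `H_m = ker (γ^{p^m} − 1)`, relative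
norms `N_{m+1,m} = Σ_{i<p} γ^{i p^m}`): `z_m ∈ H_m` and `N_{m+1,m} z_{m+1} = p^{(m+1) mod 2} · z_m`, i.e. the relative
norm loses exactly one factor `p` every SECOND layer (`N z₁ = p z₀`, `N z₂ = z₁`, `N z₃ = p z₂`, …). This is the shape
of `z_m = p^{⌈m/2⌉ + C} · y_m` for an exactly norm-compatible family `y_m` with denominators `p^{⌈m/2⌉+C}` (order 1/2),
to be contrasted with the barrier's cumulative family (`towerNorm_cumulative_succ`: a factor `p` at EVERY layer,
order 1). -/
def IsHalfTraceFamily (γ : Module.End R H) (p : ℕ) (z : ℕ → H) : Prop :=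
  (∀ m, z m ∈ towerLayer γ p m) ∧
    ∀ m, towerNorm γ p m (z (m + 1)) = ((p : R) ^ ((m + 1) % 2)) • z m

/-- Double-step law of a half-trace family: `N_{m+1,m} (N_{m+2,m+1} z_{m+2}) = p · z_m` — one factor `p` per TWO layers
(degree `p²`), the signature of order `1/2`. -/
theorem towerNorm_towerNorm_of_isHalfTraceFamily {γ : Module.End R H} {p : ℕ} {z : ℕ → H}
    (h : IsHalfTraceFamily γ p z) (m : ℕ) :
    towerNorm γ p m (towerNorm γ p (m + 1) (z (m + 1 + 1))) = (p : R) • z m := by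
  have hmod : (m + 1 + 1) % 2 + (m + 1) % 2 = 1 := by omega
  rw [h.2 (m + 1), map_smul, h.2 m, smul_smul, ← pow_add, hmod, pow_one]

/-- A half-trace family all of whose members vanish from some layer on is identically zero below that layer as soon
as `p` is a non-zero-divisor on `H` and… — NOT claimed; instead the honest elementary fact: the bottom member is a
`p`-power multiple of every double norm, `p^k • z 0 = N_{1,0} ∘ ⋯ ∘ N_{2k,2k-1} (z (2k))`, recorded for `k = 1`. -/
theorem towerNorm_towerNorm_zero_of_isHalfTraceFamily {γ : Module.End R H} {p : ℕ} {z : ℕ → H}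
    (h : IsHalfTraceFamily γ p z) :
    towerNorm γ p 0 (towerNorm γ p 1 (z 2)) = (p : R) • z 0 :=
  towerNorm_towerNorm_of_isHalfTraceFamily h 0

end Abstract

section Arithmetic

open WeierstrassCurve NumberField Field
open Literature.NumberTheory.EllipticCurves Literature.NumberTheory.EllipticCurves.ModularForms
open Summit.BirchSwinnertonDyer.Rank1Residual.Additive

/-- **First lemma of the line (K1, typed): half-order norm divisibility of the Heegner point in the anticyclotomic
tower at the wild prime 3.** On a wild row of the cell (`ClassO6 W 3`, `ρ̄_{E,3}` surjective, analytic rank one,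
`K` Heegner for `N`, `κ` the anticyclotomic `ℤ₃`-extension) there is a constant `C` and a family of points
`z_m ∈ E(K̄)` with `z_m` rational over the layer `K_m` (fixed by `κ.layerSubgroup m`), `z_0 = 3^C · y_K`
(`y_K = Norm_{K[1]/K} P[1]`, `IsHeegnerNormPoint … 0 1 y`), and HALF-TRACE relations
`Tr_{K_{m+1}/K_m} z_{m+1} = 3^{(m+1) mod 2} · z_m` (the trace written, as in the tree's `IsHeegnerNormPoint`, as a sum
over a transversal `T ⊆ Gal(K̄/K_m)` of `Gal(K̄/K_{m+1})`). Consequence: `3^{⌈m/2⌉+C} · y_K ∈ N_{K_m/K} E(K_m)` for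
every `m` — the norm index of `y_K` grows at most like `3^{m/2}` (order 1/2), against the order-1 growth that a
`𝔾_a`-type local behaviour or the universal-lattice bound (B-g32-1) would force. The intended witnesses are
`z_m = 3^{⌈m/2⌉+C} · y_m`, `y_m = Φ_*(3^{-m} Σ_{b mod 3^m} ζ_{3^m}^{-b} x_{(b)})` the universal toric family of
mixed-conductor CM points `x_{(b)} = Φ(z₀ − b/3^m) ∈ E(K[3^m])`. RESEARCH; nothing asserted. -/
def UniversalToricHalfOrderAtThree : Prop :=
  ∀ (W : WeierstrassCurve ℚ) [W.IsElliptic] [W.IsGloballyMinimal] (N : ℕ) [NeZero N]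
    (K : Type) [Field K] [NumberField K] (κ : ZpExtension K 3)
    (jbar : AlgebraicClosure K →+* ℂ) (Dt : ModularParametrizationData W N) (β : ℤ)
    (y : geomPoints (W.baseChange K)),
    ClassO6 W 3 → W.HasSurjectiveModNGaloisRep 3 → W.analyticRank = 1 → W.conductorNorm ℤ = N →
    IsImaginaryQuadratic K → SatisfiesHeegnerHypothesis N K → κ.IsAnticyclotomic →
    IsHeegnerNormPoint N W K κ Dt β jbar 0 1 y →
    ∃ (C : ℕ) (z : ℕ → geomPoints (W.baseChange K)),
      z 0 = ((3 : ℤ) ^ C) • y ∧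
      (∀ m, ∀ σ ∈ κ.layerSubgroup m, σ • z m = z m) ∧
      ∀ (m : ℕ) (T : Finset (absoluteGaloisGroup K)),
        (↑T ⊆ (κ.layerSubgroup m : Set (absoluteGaloisGroup K))) →
        (∀ τ ∈ κ.layerSubgroup m, ∃! r, r ∈ T ∧ r⁻¹ * τ ∈ κ.layerSubgroup (m + 1)) →
        ∑ r ∈ T, r • z (m + 1) = ((3 : ℤ) ^ ((m + 1) % 2)) • z m

/-- **Signed reading (K1 ⇒ ♯/♭ input), typed as an implication to be proved later, NOT asserted:** a family as in
`UniversalToricHalfOrderAtThree`, read in `H = E(K_∞) ⊗ ℤ₃` with `γ` a topological generator, is a half-trace family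
in the sense of `IsHalfTraceFamily` — the relative norm to layer `m` of a `K_{m+1}`-rational point is the transversal
sum. (Bookkeeping bridge between (B) and (A); stated so that a prover can discharge it from
`IsHeegnerNormPoint.smul_eq_self`-style group theory.) -/
def HalfTraceBridge : Prop :=
  ∀ {R : Type} [CommRing R] {H : Type} [AddCommGroup H] [Module R H] (γ : Module.End R H) (z : ℕ → H),
    (∀ m, z m ∈ towerLayer γ 3 m) →
    (∀ m, towerNorm γ 3 m (z (m + 1)) = ((3 : R) ^ ((m + 1) % 2)) • z m) →
    IsHalfTraceFamily γ 3 z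

theorem halfTraceBridge : HalfTraceBridge := by
  intro R _ H _ _ γ z hmem hnorm
  exact ⟨hmem, fun m => by simpa using hnorm m⟩

end Arithmetic

end Summit.BirchSwinnertonDyer.BirchSwinnertonDyer.Cruxes.RationalSplitIMCInclusionAtThree.UniversalToricHalfOrder
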